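import Summits.QuantumFields.BalabanUV.Beta.GAN24.ArrowNorms
import Literature.MathematicalPhysics.QuantumFieldTheory.Balaban1983to89.Beta.FibreInverseDecay

/-!
# `BalabanUV.Beta.GAN24.FibreDetStripOfAnchors` — binder row G-an2-4 / (CONV-C), road P1-fibre, p1 row **P1-L10** `FibreStrip` ((I3′), the strip
# half of the K-slot), cut «(M4) scaled alias-space Neumann, two anchors» (`HOME/b2b-balaban-gan24-formalise-leaf-16/L10-CUT-M4.md`), row **F7**
# `FibreDetStrip`, part 1: THE TWO-ANCHOR STRIP LEMMA AS A FUNCTION OF THE FOUR SHAPES F3–F6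

NOT IN PRINT; OUR PROOF ATTEMPT (of the road; THIS file is [folklore] bookkeeping: two Neumann steps and a case split on the strip).
HONEST FRAMING (cell contract, verbatim): «discharging `BetaPertH` makes Bałaban's UV stability UNCONDITIONAL — a real constructive-QFT result;
it is NOT the continuum limit and NOT the Clay problem.»  HONEST DEPENDENCY (verbatim): «continuum YM on T⁴ ⇐ BetaPertH ∧ nine spine estimates
(0/9 proved); BetaPertH ⇐ (D1) ∧ (D4) ∧ CAP+tail; G-an2-4 gates asym, D1 and NE2/3/4.»  No cited fact, no wall binder, no `def … : Prop` hypothesis,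
no `def` at all; every hypothesis is an explicit inequality.  Nothing of the K-slot `GAN24.CombesThomas.ConvCK 3 Lc` of (CONV-C) is discharged here.
NOT summit progress.

## What is proved (generic dimension `D`, generic square index type `n`; `‖·‖` on matrices = Mathlib's scoped `Matrix.Norms.L2Operator` norm, as in F1b `ArrowNorms`)
Row F7 of the cut concludes, from the four rows F3 (inner anchor `aZ`), F4 (inner Lipschitz `cIn` on the polydisc `|p|∞ ≤ ρ₁`), F5 (outer anchor `aR` on the
punctured real zone) and F6 (outer Lipschitz `cOut·|η|·ω(q)`, `ω(q) = 1 + 1/|q|` in the cut), that the scaled arrow operator is invertible with an a-priori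
bound at EVERY point of the strip `B4Strip.Strip D κ₀`, for explicit symbolic `ρ₀`, `κ₀`.  This file is that deduction with the four rows as HYPOTHESES on two
ABSTRACT matrix families — `Gin p` (inner scaling, anchored at `p = 0`) and `Gout q p` (outer scaling frozen at a real anchor `q`) — so that the literal
conclusions of F3–F6 (filed by their owners against F1's `innerArrow`/`outerArrow`) discharge them by instantiation (part 2 `GAN24/FibreDetStrip`):
* §1 strip geometry: `‖p μ‖ ≤ |Re p μ| + |Im p μ|` on the strip, the dichotomy `(∀ μ, |Re p μ| < ρ₀/2) ∨ (∃ μ, ρ₀/2 ≤ |Re p μ|)`, `reVec p ≠ 0` in the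
  outer case, the real case `p = ofRealVec (reVec p)` and the DIRECTION DECOMPOSITION `p μ = Re p μ + (η·a μ)·i` with `|a μ| ≤ 1`, `η = ` any bound of `|Im p|`;
* §2 the modulus controls `|q μ| ≤ |q|₂`, `|q μ| ≤ ‖q‖∞`, and `r ≤ s ⇒ 1 + 1/s ≤ 1 + 1/r` (so `ω(q) ≤ 1 + 2/ρ₀` in the outer case, either norm);
* §3 **`inner_case`**: F3 + F4 + `ρ₀ ≤ ρ₁`, `2·aZ·cIn·ρ₀ ≤ 1`, `κ₀ ≤ ρ₀/2` ⇒ on `Strip D κ₀ ∩ {|Re p|∞ ≤ ρ₀/2}`: `IsUnit (Gin p) ∧ ‖(Gin p)⁻¹‖ ≤ 2aZ`;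
  **`outer_case`**: F5 + F6 (re/im form) + `ω ≤ Ω` off the inner box + `κ₀ ≤ η₁`, `2·aR·cOut·κ₀·Ω ≤ 1` ⇒ on `Strip D κ₀ ∩ {∃ μ, ρ₀/2 ≤ |Re p μ|}`:
  `IsUnit (Gout (reVec p) p) ∧ ‖(Gout (reVec p) p)⁻¹‖ ≤ 2aR`; **`apriori_on_strip`** (the disjunction, WITH the region information and `reVec p ≠ 0`
  in the outer branch — row F8 picks its leg scaling from it), `apriori_on_strip_max` (common bound `2·max aZ aR`) and **`of_strip`** (any property `P p`
  implied by invertibility in either scaling — the outer one at anchors `reVec p ∈ BZ ∖ {0}` only — holds on the whole strip; (U1) is `P p := det ≠ 0` via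
  F1a's `det_trigPolySymbol_ne_zero_of_isUnit` and F1c's `isUnit_scaled_iff`, instantiated in part 2);
* §4 **`outerLipschitz_of_dir`**: the (η, a)-DIRECTION form of F6 (`p = q + iη·a`, `|a|∞ ≤ 1`, `0 ≤ η ≤ η₁`) implies the re/im form used in §3;
* §5 **`exists_radii`**: admissible `(ρ₀, κ₀)` with `0 < κ₀` exist for any nonnegative constants and any outer modulus bound `Ω(ρ₀) ≥ 0` (F9's `∃ κ > 0`).
Engine: F1b `ArrowNorms.perturb` BY NAME; `B4Strip.Strip/reVec/ofRealVec`, `B4ContourShift.BZ`, `FibreInverseDecay.reVec_mem_BZ` BY NAME.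
Unit `b2b-balaban-gan24-formalise-leaf-09` (G-an2-4 formalisation swarm, leaf prover 09, gen 6), 2026-08-20.
-/

noncomputable section

open Matrix Complex
open scoped Matrix.Norms.L2Operator
open Literature.MathematicalPhysics.QuantumFieldTheory.Balaban1983to89
open B4Strip (Strip reVec ofRealVec)
open B4ContourShift (BZ)
open Beta.FibreInverseDecay (reVec_mem_BZ)
open Summit.QuantumFields.BalabanUV.Beta.GAN24.ArrowNorms (perturb)

namespace Summit.QuantumFields.BalabanUV.Beta.GAN24.FibreDetStripOfAnchors

variable {D : ℕ}

/-! ## §1 Strip geometry -/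

/-- [folklore] On the strip, every coordinate has modulus at most `|Re| + κ`. -/
theorem norm_apply_le_of_strip {κ r : ℝ} {p : Fin D → ℂ} (hp : p ∈ Strip D κ) (hre : ∀ μ, |(p μ).re| ≤ r) (μ : Fin D) :
    ‖p μ‖ ≤ r + κ :=
  (norm_le_abs_re_add_abs_im (p μ)).trans (add_le_add (hre μ) (hp μ).2)

/-- [folklore] The inner/outer DICHOTOMY of the cut: either every real coordinate is `< r`, or some real coordinate is `≥ r`. -/
theorem dichotomy (p : Fin D → ℂ) (r : ℝ) : (∀ μ, |(p μ).re| < r) ∨ (∃ μ, r ≤ |(p μ).re|) := by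
  by_cases h : ∀ μ, |(p μ).re| < r
  · exact Or.inl h
  · push Not at h
    exact Or.inr h

/-- [folklore] `reVec p μ = Re (p μ)`. -/
theorem reVec_apply (p : Fin D → ℂ) (μ : Fin D) : reVec p μ = (p μ).re := rfl

/-- [folklore] In the outer case the real anchor is NOT the origin. -/
theorem reVec_ne_zero {r : ℝ} (hr : 0 < r) {p : Fin D → ℂ} {μ : Fin D} (hμ : r ≤ |(p μ).re|) : reVec p ≠ 0 := by
  intro h
  have h1 : (p μ).re = 0 := by
    have := congrFun h μ
    simpa [reVec_apply] using this
  rw [h1, abs_zero] at hμ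
  exact absurd hμ (not_le.mpr hr)

/-- [folklore] A real anchor `q` one of whose coordinates is `≥ r > 0` in modulus is not the origin. -/
theorem ne_zero_of_coord {r : ℝ} (hr : 0 < r) {q : Fin D → ℝ} {μ : Fin D} (hμ : r ≤ |q μ|) : q ≠ 0 := by
  intro h
  rw [h, Pi.zero_apply, abs_zero] at hμ
  exact absurd hμ (not_le.mpr hr)

/-- [folklore] A point with zero imaginary parts IS its real anchor: `p = ofRealVec (reVec p)`. -/
theorem eq_ofRealVec_reVec {p : Fin D → ℂ} (h : ∀ μ, (p μ).im = 0) : p = ofRealVec (reVec p) := by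
  funext μ
  apply Complex.ext
  · simp [ofRealVec, reVec_apply]
  · simp [ofRealVec, h μ]

/-- [folklore] `|Im p μ| ≤ 0` for all `μ` forces `p = ofRealVec (reVec p)`. -/
theorem eq_ofRealVec_reVec_of_abs_im_le_zero {p : Fin D → ℂ} (h : ∀ μ, |(p μ).im| ≤ 0) : p = ofRealVec (reVec p) :=
  eq_ofRealVec_reVec fun μ => abs_nonpos_iff.mp (h μ)

/-- [folklore] **DIRECTION DECOMPOSITION.**  If `|Im p μ| ≤ η` for all `μ` and `0 < η`, then `p = Re p + iη·a` coordinatewise with a REAL direction `a`,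
`|a μ| ≤ 1` (namely `a μ = Im p μ / η`) — the parametrisation `p ↦ p + iη·a` of the cut's row F6. -/
theorem exists_dir {η : ℝ} (hη : 0 < η) {p : Fin D → ℂ} (h : ∀ μ, |(p μ).im| ≤ η) :
    ∃ a : Fin D → ℝ, (∀ μ, |a μ| ≤ 1) ∧ ∀ μ, p μ = ((reVec p μ : ℝ) : ℂ) + ((η * a μ : ℝ) : ℂ) * I := by
  refine ⟨fun μ => (p μ).im / η, fun μ => ?_, fun μ => ?_⟩
  · rw [abs_div, abs_of_pos hη, div_le_one hη]
    exact h μ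
  · have e : η * ((p μ).im / η) = (p μ).im := mul_div_cancel₀ _ hη.ne'
    rw [e]
    apply Complex.ext
    · simp [reVec_apply]
    · simp [reVec_apply]

/-! ## §2 Modulus controls for the outer Lipschitz modulus `ω(q) = 1 + 1/|q|` -/

/-- [folklore] A coordinate is dominated by the Euclidean length: `|q μ| ≤ √(Σ_ν q_ν²)`. -/
theorem abs_le_sqrt_sum_sq (q : Fin D → ℝ) (μ : Fin D) : |q μ| ≤ Real.sqrt (∑ ν, q ν ^ 2) := by
  rw [← Real.sqrt_sq_eq_abs]
  exact Real.sqrt_le_sqrt (Finset.single_le_sum (fun ν _ => sq_nonneg (q ν)) (Finset.mem_univ μ))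

/-- [folklore] A coordinate is dominated by the sup norm: `|q μ| ≤ ‖q‖`. -/
theorem abs_le_pi_norm (q : Fin D → ℝ) (μ : Fin D) : |q μ| ≤ ‖q‖ := by
  rw [← Real.norm_eq_abs]
  exact norm_le_pi_norm q μ

/-- [folklore] `1 + 1/s ≤ 1 + 1/r` for `0 < r ≤ s`: the outer modulus `1 + 1/|q|` is at most `1 + 2/ρ₀` once some `|q μ| ≥ ρ₀/2`. -/
theorem one_add_inv_le {r s : ℝ} (hr : 0 < r) (hrs : r ≤ s) : 1 + 1 / s ≤ 1 + 1 / r := by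
  gcongr

/-- [folklore] The Euclidean instance of the control: `ρ₀/2 ≤ |q μ|` ⇒ `1 + 1/√(Σ q²) ≤ 1 + 2/ρ₀`. -/
theorem one_add_inv_sqrt_le {ρ₀ : ℝ} (hρ₀ : 0 < ρ₀) {q : Fin D → ℝ} {μ : Fin D} (hμ : ρ₀ / 2 ≤ |q μ|) :
    1 + 1 / Real.sqrt (∑ ν, q ν ^ 2) ≤ 1 + 2 / ρ₀ := by
  have h := one_add_inv_le (half_pos hρ₀) (hμ.trans (abs_le_sqrt_sum_sq q μ))
  rwa [one_div (ρ₀ / 2), inv_div] at h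

/-- [folklore] The sup-norm instance of the control: `ρ₀/2 ≤ |q μ|` ⇒ `1 + 1/‖q‖ ≤ 1 + 2/ρ₀`. -/
theorem one_add_inv_norm_le {ρ₀ : ℝ} (hρ₀ : 0 < ρ₀) {q : Fin D → ℝ} {μ : Fin D} (hμ : ρ₀ / 2 ≤ |q μ|) :
    1 + 1 / ‖q‖ ≤ 1 + 2 / ρ₀ := by
  have h := one_add_inv_le (half_pos hρ₀) (hμ.trans (abs_le_pi_norm q μ))
  rwa [one_div (ρ₀ / 2), inv_div] at h

/-! ## §3 The two Neumann steps and the strip -/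

variable {n : Type*} [Fintype n] [DecidableEq n]

/-- [folklore] **INNER CASE** (anchor `p = 0`, rows F3 + F4).  If `Gin 0` is invertible with `‖(Gin 0)⁻¹‖ ≤ aZ`, `‖Gin p − Gin 0‖ ≤ cIn·r` whenever all
`‖p μ‖ ≤ r ≤ ρ₁`, and the radii satisfy `ρ₀ ≤ ρ₁`, `2·aZ·cIn·ρ₀ ≤ 1`, `κ₀ ≤ ρ₀/2`, then at every strip point with `|Re p|∞ ≤ ρ₀/2`:
`IsUnit (Gin p)` and `‖(Gin p)⁻¹‖ ≤ 2·aZ` (F1b `ArrowNorms.perturb`). -/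
theorem inner_case (Gin : (Fin D → ℂ) → Matrix n n ℂ) {aZ cIn ρ₁ ρ₀ κ₀ : ℝ}
    (hZ : IsUnit (Gin 0) ∧ ‖(Gin 0)⁻¹‖ ≤ aZ)
    (hLip : ∀ (p : Fin D → ℂ) (r : ℝ), (∀ μ, ‖p μ‖ ≤ r) → r ≤ ρ₁ → ‖Gin p - Gin 0‖ ≤ cIn * r)
    (haZ : 0 ≤ aZ) (hρ : ρ₀ ≤ ρ₁) (hsmall : 2 * aZ * cIn * ρ₀ ≤ 1) (hκ : κ₀ ≤ ρ₀ / 2)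
    {p : Fin D → ℂ} (hp : p ∈ Strip D κ₀) (hin : ∀ μ, |(p μ).re| ≤ ρ₀ / 2) :
    IsUnit (Gin p) ∧ ‖(Gin p)⁻¹‖ ≤ 2 * aZ := by
  have hr : ∀ μ, ‖p μ‖ ≤ ρ₀ := fun μ => (norm_apply_le_of_strip hp hin μ).trans (by linarith)
  have hd : ‖Gin p - Gin 0‖ ≤ cIn * ρ₀ := hLip p ρ₀ hr hρ
  refine perturb hZ.1 hZ.2 ?_
  calc ‖Gin p - Gin 0‖ * aZ ≤ cIn * ρ₀ * aZ := mul_le_mul_of_nonneg_right hd haZ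
    _ = (2 * aZ * cIn * ρ₀) / 2 := by ring
    _ ≤ 1 / 2 := by linarith

/-- [folklore] **OUTER CASE** (anchor `Re p`, rows F5 + F6).  If for every real `q ∈ BZ ∖ {0}` the anchor `Gout q (ofRealVec q)` is invertible with
`‖inverse‖ ≤ aR`, the imaginary shift at fixed real part costs `‖Gout q p − Gout q (ofRealVec q)‖ ≤ cOut·η·ω q` whenever `reVec p = q`, `|Im p μ| ≤ η`,
`0 ≤ η ≤ η₁`, the modulus is controlled by `ω q ≤ Ω` as soon as some `|q μ| ≥ ρ₀/2`, and `κ₀ ≤ η₁`, `2·aR·cOut·κ₀·Ω ≤ 1`, then at every strip point with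
some `|Re p μ| ≥ ρ₀/2`: `IsUnit (Gout (reVec p) p)` and `‖(Gout (reVec p) p)⁻¹‖ ≤ 2·aR`. -/
theorem outer_case (Gout : (Fin D → ℝ) → (Fin D → ℂ) → Matrix n n ℂ) (ω : (Fin D → ℝ) → ℝ) {aR cOut η₁ ρ₀ κ₀ Ω : ℝ}
    (hR : ∀ q ∈ BZ D, q ≠ 0 → IsUnit (Gout q (ofRealVec q)) ∧ ‖(Gout q (ofRealVec q))⁻¹‖ ≤ aR)
    (hLip : ∀ q ∈ BZ D, q ≠ 0 → ∀ p : Fin D → ℂ, reVec p = q → ∀ η : ℝ, 0 ≤ η → η ≤ η₁ → (∀ μ, |(p μ).im| ≤ η) →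
      ‖Gout q p - Gout q (ofRealVec q)‖ ≤ cOut * η * ω q)
    (hω : ∀ q ∈ BZ D, (∃ μ, ρ₀ / 2 ≤ |q μ|) → ω q ≤ Ω)
    (haR : 0 ≤ aR) (hcOut : 0 ≤ cOut) (hρ₀ : 0 < ρ₀) (hκ₀ : 0 ≤ κ₀) (hκη : κ₀ ≤ η₁) (hsmall : 2 * aR * cOut * κ₀ * Ω ≤ 1)
    {p : Fin D → ℂ} (hp : p ∈ Strip D κ₀) (hout : ∃ μ, ρ₀ / 2 ≤ |(p μ).re|) :
    IsUnit (Gout (reVec p) p) ∧ ‖(Gout (reVec p) p)⁻¹‖ ≤ 2 * aR := by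
  obtain ⟨μ, hμ⟩ := hout
  have hq : reVec p ∈ BZ D := reVec_mem_BZ hp
  have hq0 : reVec p ≠ 0 := reVec_ne_zero (half_pos hρ₀) hμ
  obtain ⟨hU, hinv⟩ := hR (reVec p) hq hq0
  have hd : ‖Gout (reVec p) p - Gout (reVec p) (ofRealVec (reVec p))‖ ≤ cOut * κ₀ * ω (reVec p) :=
    hLip (reVec p) hq hq0 p rfl κ₀ hκ₀ hκη fun ν => (hp ν).2
  have hΩ : ω (reVec p) ≤ Ω := hω (reVec p) hq ⟨μ, hμ⟩
  have hd' : ‖Gout (reVec p) p - Gout (reVec p) (ofRealVec (reVec p))‖ ≤ cOut * κ₀ * Ω :=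
    hd.trans (mul_le_mul_of_nonneg_left hΩ (mul_nonneg hcOut hκ₀))
  refine perturb hU hinv ?_
  calc ‖Gout (reVec p) p - Gout (reVec p) (ofRealVec (reVec p))‖ * aR ≤ cOut * κ₀ * Ω * aR := mul_le_mul_of_nonneg_right hd' haR
    _ = (2 * aR * cOut * κ₀ * Ω) / 2 := by ring
    _ ≤ 1 / 2 := by linarith

/-- [folklore] **THE A-PRIORI BOUND ON THE WHOLE STRIP** (row F7 minus the instantiation): under the hypotheses of `inner_case` and `outer_case`, at every
`p ∈ Strip D κ₀` ONE of the two scaled operators is invertible — the inner one, with `‖inverse‖ ≤ 2·aZ`, if `|Re p|∞ < ρ₀/2`; otherwise the outer one anchored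
at `reVec p` (then `reVec p ≠ 0`, some `|Re p μ| ≥ ρ₀/2`), with `‖inverse‖ ≤ 2·aR`.  The region information is part of the conclusion (row F8 needs it to pick the
leg scaling). -/
theorem apriori_on_strip (Gin : (Fin D → ℂ) → Matrix n n ℂ) (Gout : (Fin D → ℝ) → (Fin D → ℂ) → Matrix n n ℂ) (ω : (Fin D → ℝ) → ℝ)
    {aZ aR cIn cOut ρ₁ η₁ ρ₀ κ₀ Ω : ℝ}
    (hZ : IsUnit (Gin 0) ∧ ‖(Gin 0)⁻¹‖ ≤ aZ)
    (hLipIn : ∀ (p : Fin D → ℂ) (r : ℝ), (∀ μ, ‖p μ‖ ≤ r) → r ≤ ρ₁ → ‖Gin p - Gin 0‖ ≤ cIn * r)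
    (hR : ∀ q ∈ BZ D, q ≠ 0 → IsUnit (Gout q (ofRealVec q)) ∧ ‖(Gout q (ofRealVec q))⁻¹‖ ≤ aR)
    (hLipOut : ∀ q ∈ BZ D, q ≠ 0 → ∀ p : Fin D → ℂ, reVec p = q → ∀ η : ℝ, 0 ≤ η → η ≤ η₁ → (∀ μ, |(p μ).im| ≤ η) →
      ‖Gout q p - Gout q (ofRealVec q)‖ ≤ cOut * η * ω q)
    (hω : ∀ q ∈ BZ D, (∃ μ, ρ₀ / 2 ≤ |q μ|) → ω q ≤ Ω)
    (haZ : 0 ≤ aZ) (haR : 0 ≤ aR) (hcOut : 0 ≤ cOut) (hρ₀ : 0 < ρ₀) (hρ : ρ₀ ≤ ρ₁) (hsmallIn : 2 * aZ * cIn * ρ₀ ≤ 1)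
    (hκ₀ : 0 ≤ κ₀) (hκ : κ₀ ≤ ρ₀ / 2) (hκη : κ₀ ≤ η₁) (hsmallOut : 2 * aR * cOut * κ₀ * Ω ≤ 1)
    {p : Fin D → ℂ} (hp : p ∈ Strip D κ₀) :
    ((∀ μ, |(p μ).re| < ρ₀ / 2) ∧ IsUnit (Gin p) ∧ ‖(Gin p)⁻¹‖ ≤ 2 * aZ) ∨
      ((∃ μ, ρ₀ / 2 ≤ |(p μ).re|) ∧ reVec p ≠ 0 ∧ IsUnit (Gout (reVec p) p) ∧ ‖(Gout (reVec p) p)⁻¹‖ ≤ 2 * aR) := by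
  rcases dichotomy p (ρ₀ / 2) with hin | hout
  · exact Or.inl ⟨hin, inner_case Gin hZ hLipIn haZ hρ hsmallIn hκ hp fun μ => (hin μ).le⟩
  · obtain ⟨μ, hμ⟩ := hout
    exact Or.inr ⟨⟨μ, hμ⟩, reVec_ne_zero (half_pos hρ₀) hμ,
      outer_case Gout ω hR hLipOut hω haR hcOut hρ₀ hκ₀ hκη hsmallOut hp ⟨μ, hμ⟩⟩

/-- [folklore] The same with ONE constant: at every strip point one of the two scaled operators is invertible with `‖inverse‖ ≤ 2·max aZ aR`. -/
theorem apriori_on_strip_max (Gin : (Fin D → ℂ) → Matrix n n ℂ) (Gout : (Fin D → ℝ) → (Fin D → ℂ) → Matrix n n ℂ) (ω : (Fin D → ℝ) → ℝ)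
    {aZ aR cIn cOut ρ₁ η₁ ρ₀ κ₀ Ω : ℝ}
    (hZ : IsUnit (Gin 0) ∧ ‖(Gin 0)⁻¹‖ ≤ aZ)
    (hLipIn : ∀ (p : Fin D → ℂ) (r : ℝ), (∀ μ, ‖p μ‖ ≤ r) → r ≤ ρ₁ → ‖Gin p - Gin 0‖ ≤ cIn * r)
    (hR : ∀ q ∈ BZ D, q ≠ 0 → IsUnit (Gout q (ofRealVec q)) ∧ ‖(Gout q (ofRealVec q))⁻¹‖ ≤ aR)
    (hLipOut : ∀ q ∈ BZ D, q ≠ 0 → ∀ p : Fin D → ℂ, reVec p = q → ∀ η : ℝ, 0 ≤ η → η ≤ η₁ → (∀ μ, |(p μ).im| ≤ η) →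
      ‖Gout q p - Gout q (ofRealVec q)‖ ≤ cOut * η * ω q)
    (hω : ∀ q ∈ BZ D, (∃ μ, ρ₀ / 2 ≤ |q μ|) → ω q ≤ Ω)
    (haZ : 0 ≤ aZ) (haR : 0 ≤ aR) (hcOut : 0 ≤ cOut) (hρ₀ : 0 < ρ₀) (hρ : ρ₀ ≤ ρ₁) (hsmallIn : 2 * aZ * cIn * ρ₀ ≤ 1)
    (hκ₀ : 0 ≤ κ₀) (hκ : κ₀ ≤ ρ₀ / 2) (hκη : κ₀ ≤ η₁) (hsmallOut : 2 * aR * cOut * κ₀ * Ω ≤ 1)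
    {p : Fin D → ℂ} (hp : p ∈ Strip D κ₀) :
    (IsUnit (Gin p) ∧ ‖(Gin p)⁻¹‖ ≤ 2 * max aZ aR) ∨
      (IsUnit (Gout (reVec p) p) ∧ ‖(Gout (reVec p) p)⁻¹‖ ≤ 2 * max aZ aR) := by
  rcases apriori_on_strip Gin Gout ω hZ hLipIn hR hLipOut hω haZ haR hcOut hρ₀ hρ hsmallIn hκ₀ hκ hκη hsmallOut hp with
    ⟨-, hU, hb⟩ | ⟨-, -, hU, hb⟩
  · exact Or.inl ⟨hU, hb.trans (by linarith [le_max_left aZ aR])⟩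
  · exact Or.inr ⟨hU, hb.trans (by linarith [le_max_right aZ aR])⟩

/-- [folklore] **(U1)-SHAPED COROLLARY.**  Any property `P p` that follows from invertibility of the inner-scaled operator, and from invertibility of the
outer-scaled operator at a real anchor `reVec p ∈ BZ ∖ {0}` (in part 2: `P p := det (fibre symbol at p) ≠ 0`, from F1a `det_trigPolySymbol_ne_zero_of_isUnit`
and F1c `isUnit_scaled_iff` — the outer scaling is nondegenerate exactly because `reVec p ≠ 0`), holds at every point of `Strip D κ₀`. -/
theorem of_strip (P : (Fin D → ℂ) → Prop) (Gin : (Fin D → ℂ) → Matrix n n ℂ) (Gout : (Fin D → ℝ) → (Fin D → ℂ) → Matrix n n ℂ)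
    (ω : (Fin D → ℝ) → ℝ) {aZ aR cIn cOut ρ₁ η₁ ρ₀ κ₀ Ω : ℝ}
    (hPin : ∀ p, IsUnit (Gin p) → P p) (hPout : ∀ p, reVec p ∈ BZ D → reVec p ≠ 0 → IsUnit (Gout (reVec p) p) → P p)
    (hZ : IsUnit (Gin 0) ∧ ‖(Gin 0)⁻¹‖ ≤ aZ)
    (hLipIn : ∀ (p : Fin D → ℂ) (r : ℝ), (∀ μ, ‖p μ‖ ≤ r) → r ≤ ρ₁ → ‖Gin p - Gin 0‖ ≤ cIn * r)
    (hR : ∀ q ∈ BZ D, q ≠ 0 → IsUnit (Gout q (ofRealVec q)) ∧ ‖(Gout q (ofRealVec q))⁻¹‖ ≤ aR)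
    (hLipOut : ∀ q ∈ BZ D, q ≠ 0 → ∀ p : Fin D → ℂ, reVec p = q → ∀ η : ℝ, 0 ≤ η → η ≤ η₁ → (∀ μ, |(p μ).im| ≤ η) →
      ‖Gout q p - Gout q (ofRealVec q)‖ ≤ cOut * η * ω q)
    (hω : ∀ q ∈ BZ D, (∃ μ, ρ₀ / 2 ≤ |q μ|) → ω q ≤ Ω)
    (haZ : 0 ≤ aZ) (haR : 0 ≤ aR) (hcOut : 0 ≤ cOut) (hρ₀ : 0 < ρ₀) (hρ : ρ₀ ≤ ρ₁) (hsmallIn : 2 * aZ * cIn * ρ₀ ≤ 1)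
    (hκ₀ : 0 ≤ κ₀) (hκ : κ₀ ≤ ρ₀ / 2) (hκη : κ₀ ≤ η₁) (hsmallOut : 2 * aR * cOut * κ₀ * Ω ≤ 1) :
    ∀ p ∈ Strip D κ₀, P p := fun p hp => by
  rcases apriori_on_strip Gin Gout ω hZ hLipIn hR hLipOut hω haZ haR hcOut hρ₀ hρ hsmallIn hκ₀ hκ hκη hsmallOut hp with
    ⟨-, hU, -⟩ | ⟨-, hq0, hU, -⟩
  · exact hPin p hU
  · exact hPout p (reVec_mem_BZ hp) hq0 hU

/-! ## §4 From the direction form of row F6 to the re/im form -/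

/-- [folklore] **ROW F6 IN DIRECTION FORM ⇒ RE/IM FORM.**  If the outer shift is controlled along every real direction `a`, `|a μ| ≤ 1`, for `0 ≤ η ≤ η₁`
(`p μ = q μ + (η·a μ)·i`), then it is controlled at every `p` with `reVec p = q` and `|Im p μ| ≤ η` (take `a μ = Im p μ/η`; `η = 0` is the anchor itself). -/
theorem outerLipschitz_of_dir (Gout : (Fin D → ℝ) → (Fin D → ℂ) → Matrix n n ℂ) (ω : (Fin D → ℝ) → ℝ) {cOut η₁ : ℝ}
    (hdir : ∀ q ∈ BZ D, q ≠ 0 → ∀ a : Fin D → ℝ, (∀ μ, |a μ| ≤ 1) → ∀ η : ℝ, 0 ≤ η → η ≤ η₁ →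
      ‖Gout q (fun μ => ((q μ : ℝ) : ℂ) + ((η * a μ : ℝ) : ℂ) * I) - Gout q (ofRealVec q)‖ ≤ cOut * η * ω q) :
    ∀ q ∈ BZ D, q ≠ 0 → ∀ p : Fin D → ℂ, reVec p = q → ∀ η : ℝ, 0 ≤ η → η ≤ η₁ → (∀ μ, |(p μ).im| ≤ η) →
      ‖Gout q p - Gout q (ofRealVec q)‖ ≤ cOut * η * ω q := by
  intro q hq hq0 p hpq η hη0 hη1 him
  rcases hη0.eq_or_lt with h0 | hpos
  · -- `η = 0`: `p` is the anchor itself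
    subst hpq
    have hp : p = ofRealVec (reVec p) := eq_ofRealVec_reVec_of_abs_im_le_zero (by simpa [← h0] using him)
    rw [← hp, sub_self, norm_zero, ← h0, mul_zero, zero_mul]
  · obtain ⟨a, ha, hpa⟩ := exists_dir hpos him
    have e : p = fun μ => ((q μ : ℝ) : ℂ) + ((η * a μ : ℝ) : ℂ) * I := by
      funext μ; rw [hpa μ, hpq]
    rw [e]
    exact hdir q hq hq0 a ha η hη0 hη1

/-! ## §5 Admissible radii exist -/

/-- [folklore] `X·ρ ≤ 1` for `ρ ≤ 1/(X + 1)`, `0 ≤ X`. -/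
theorem mul_le_one_of_le_inv_add_one {X ρ : ℝ} (hX : 0 ≤ X) (h : ρ ≤ 1 / (X + 1)) : X * ρ ≤ 1 := by
  have hX1 : 0 < X + 1 := by linarith
  calc X * ρ ≤ X * (1 / (X + 1)) := mul_le_mul_of_nonneg_left h hX
    _ = X / (X + 1) := by rw [mul_one_div]
    _ ≤ 1 := (div_le_one hX1).mpr (by linarith)

/-- [folklore] **ADMISSIBLE RADII EXIST.**  For nonnegative anchor/Lipschitz constants, positive `ρ₁`, `η₁` and any nonnegative outer modulus bound `Ω(ρ₀)`
(in the cut: `Ω(ρ₀) = 1 + 2/ρ₀`), there are `0 < ρ₀ ≤ ρ₁` and `0 < κ₀ ≤ min(ρ₀/2, η₁)` with `2·aZ·cIn·ρ₀ ≤ 1` and `2·aR·cOut·κ₀·Ω(ρ₀) ≤ 1` — the smallness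
hypotheses of §3 (row F9's `∃ κ > 0`). -/
theorem exists_radii {aZ aR cIn cOut ρ₁ η₁ : ℝ} (Ω : ℝ → ℝ) (haZ : 0 ≤ aZ) (haR : 0 ≤ aR) (hcIn : 0 ≤ cIn) (hcOut : 0 ≤ cOut)
    (hρ₁ : 0 < ρ₁) (hη₁ : 0 < η₁) (hΩ : ∀ ρ, 0 < ρ → 0 ≤ Ω ρ) :
    ∃ ρ₀ κ₀ : ℝ, 0 < ρ₀ ∧ ρ₀ ≤ ρ₁ ∧ 2 * aZ * cIn * ρ₀ ≤ 1 ∧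
      0 < κ₀ ∧ κ₀ ≤ ρ₀ / 2 ∧ κ₀ ≤ η₁ ∧ 2 * aR * cOut * κ₀ * Ω ρ₀ ≤ 1 := by
  set X : ℝ := 2 * aZ * cIn with hX
  have hX0 : 0 ≤ X := by rw [hX]; positivity
  set ρ₀ : ℝ := min ρ₁ (1 / (X + 1)) with hρ₀
  have hρ₀pos : 0 < ρ₀ := lt_min hρ₁ (by positivity)
  set Y : ℝ := 2 * aR * cOut * Ω ρ₀ with hY
  have hY0 : 0 ≤ Y := by rw [hY]; exact mul_nonneg (by positivity) (hΩ ρ₀ hρ₀pos)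
  set κ₀ : ℝ := min (ρ₀ / 2) (min η₁ (1 / (Y + 1))) with hκ₀
  have hκ₀pos : 0 < κ₀ := lt_min (half_pos hρ₀pos) (lt_min hη₁ (by positivity))
  refine ⟨ρ₀, κ₀, hρ₀pos, min_le_left _ _, ?_, hκ₀pos, min_le_left _ _, (min_le_right _ _).trans (min_le_left _ _), ?_⟩
  · have h := mul_le_one_of_le_inv_add_one hX0 (min_le_right ρ₁ _)
    rw [hX] at h; linarith [h]
  · have h : Y * κ₀ ≤ 1 :=
      mul_le_one_of_le_inv_add_one hY0 (((min_le_right (ρ₀ / 2) _).trans (min_le_right η₁ _)).trans_eq rfl)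
    have e : 2 * aR * cOut * κ₀ * Ω ρ₀ = Y * κ₀ := by rw [hY]; ring
    rw [e]; exact h

end Summit.QuantumFields.BalabanUV.Beta.GAN24.FibreDetStripOfAnchors

end
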